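import Literature.MathematicalPhysics.QuantumFieldTheory.Balaban1983to89.B9Eq3147
import Literature.MathematicalPhysics.QuantumFieldTheory.Balaban1983to89.B9SectDSup

/-!
# `Balaban1983to89.B9Thm313RightEntries` — T. Bałaban, *Propagators for lattice gauge theories in a background field*, Commun. Math. Phys.
**99** (1985) 389–434 [Balaban1985BackgroundPropagators], Sect. D, p. 426, THE REDUCTION STEP OF THEOREM 3.13: «The formulas (3.147), (3.153)
permit us to reduce properties of the operators 𝔓, 𝔊 to the corresponding properties of the operators G′, (Q′G′²Q′*)⁻¹, G₁, (QG₁Q*)⁻¹» —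
for the propagator `𝔊 = G₁ − G₁DRD*G₁ − G₁Q*(QG₁Q*)⁻¹QG₁` ((3.153)) the RIGHT (sup-type) ENTRIES of Theorem 3.3 follow from the letters
for `G₁` (Theorem 3.12), `(QG₁Q*)⁻¹` ((3.132)) and `RG′D*` (Theorem 3.1 + (3.49)) by [4] (2.52)–(2.55), the middle term through (3.152)
`RD*G₁ = RG′D*` — TYPED over r16's block norms with the operator `𝔊` = pub-balaban B09's `B9Eq3147.frakG` (the identity (3.153) BY NAME,
`B9Eq3147.eq_3153`); FILE 79 of the Sect. B–D programme of cell `lit-balaban`, seat r06 (B9 fold owner); rows **B9.Thm3.13** (member cell; the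
head is the lead's word) and **B9.Eq3.139** ((3.147), member cell)

statement-level skeleton of published theorems with citation tags; proofs where landed; nothing here is a claim about the Yang–Mills mass gap

CITATION HEADER (lean-in-tree rule).  B9 = [Balaban1985BackgroundPropagators] (held `paper:balaban1985-cmp99-background-propagators`, journal
page = PDF page + 388; text layer p0038 and render `b2b-balaban-ref1/pages/…-p038-x2.png` READ AS AN IMAGE by this seat 2026-08-24).  p. 426 [PDF 38]: «The equalities
(3.150), (3.152) give 𝔊 = G₁ − G₁DRD\*G₁ − DG′RG′D\* + DG′RG′D\*DRG′D\* − G₁Q\*(QG₁Q\*)⁻¹QG₁ = G₁ − G₁DRD\*G₁ − G₁Q\*(QG₁Q\*)⁻¹QG₁ = G₁𝔓\* =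
𝔓G₁. (3.153) The formulas (3.147), (3.153) permit us to reduce properties of the operators 𝔓, 𝔊 to the corresponding properties of the
operators G′, (Q′G′²Q′\*)⁻¹, G₁, (QG₁Q\*)⁻¹. Especially for 𝔊 we have, assuming (3.132) Theorem 3.13. If an external gauge field
configuration U satisfies the regularity conditions (3.35), (3.36) for α₀ sufficiently small, then Theorems 3.3, 3.10, 3.11 hold for the
propagator 𝔊, with the exception of the inequality in (3.42) involving the covariant Laplace operator.»; (3.152) p. 426 «RD\*G₁ = RG′D\*, and
G₁DR = DG′R»; (3.132) p. 422 «|(QGQ\*)⁻¹(y,y′)| ≦ O(1)(Lʲη)⁻²(L^{j′}η)^{−d}e^{−δ₁d(y,y′)} … and the same for the operator with G₁ instead of G»;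
Theorem 3.12 p. 423 (Theorems 3.3, 3.10, 3.11 for G₁).  [4] = [Balaban1984PropagatorsII] (2.52)–(2.55) p. 232, Lemma 2.1 (2.61) p. 234.

WHAT IS PROVED (kernel; theorems only — 0 `def`, 0 named fact, 0 sorry).
* §1 (matrix algebra, generic rectangular letters `G : X × X`, `D : X × n`, `R : n × n`, `Qb : q × X`, `C : q × q`): `mulVecLin_frakG_shape` —
  `G − GDRD*G − GQ*CQG` as linear maps is `G − (GD)∘(RD*G) − (GQ*)∘C∘(QG)`; `mulVecLin_frakG_shape_152` — with (3.152) `RD*G = RG′D*` the middle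
  factor is the letter `RG′D*` (the one of FILES 77/78).
* §2 (block majorants, [4] (2.52)–(2.55)): **`hasMaj_frakG_shape`** — letters `G : bA → bC` (`Be^{−δd}`, Theorem 3.12's (3.42)₁/(3.43)₁-type right
  entry of `G₁`), `GD : bP → bC` (`B′e^{−δd}`, the (3.42)₃/(3.43)₂/(3.45)-type entry), `RG′D* : bA → bP` (`B₁e^{−δd}`), `GQ* : bQ → bC` (`B_He^{−δd}`,
  the `H`-type entry (3.133)/(3.126)), `C = (QG₁Q*)⁻¹ : bQ → bQ` (`B_Ce^{−δd}`, (3.132)), `QG : bA → bQ` (`B_Qe^{−δd}`) ⟹ the composite has the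
  majorant `(B + κ_PB′B₁c + κ_Qκ_QB_HB_CB_Qc²)·e^{−ρd}` for `ρ + 2σ ≦ δ` — «reduce properties of 𝔊 to the corresponding properties of G₁,
  (QG₁Q\*)⁻¹».
* §3 **`hasMaj_frakG`** — THE SAME FOR pub-balaban B09's `𝔊 = B9Eq3147.frakG K Δ Q a N D Qb` (the covariance (3.148)) under the hypotheses of
  `B9Eq3147.eq_3153` (whose third member `𝔊 = G − GDRD*G − GQb*(QbGQb*)⁻¹QbG`, `G = (Ginv K …)⁻¹`, and `B9Eq3152.sectD_hypotheses`' (3.152)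
  `RD*G = RG′D*` are invoked BY NAME): right entries of `𝔊` from the letters for `G`, `GD`, `RG′D*`, `GQb*`, `(QbGQb*)⁻¹`, `QbG`.

* §4 `mulVecLin_one_sub_frakP_shape`, **`hasMaj_one_sub_frakP_shape`**, **`hasMaj_one_sub_frakP`** — the companion reduction for `𝔓` of (3.147):
  `I − 𝔓 = G₁Q*(QG₁Q*)⁻¹Q + G₁DRD*` from the letters `G₁Q*`, `(QG₁Q*)⁻¹`, `Q`, `G₁D`, `RD*` (print: through `R` to `G′`, `(Q′G′²Q′*)⁻¹`), for B09's
  `frakP` with `B9Eq3147.eq_3147` BY NAME.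
* §5 `hasMaj_frakG_of_frakP`, `hasMaj_frakG_of_frakP_transpose` — (3.153)'s outer members «𝔊 = G₁𝔓\* = 𝔓G₁» (first/second conjuncts of
  `B9Eq3147.eq_3153`, BY NAME): entries of `𝔊` from a letter for `𝔓` (resp. `𝔓*`) and one for `G` by a single [4] (2.52)–(2.55) composition.

HONEST SCOPE / NOT CLAIMED.  (i) All letters are HYPOTHESES of the printed exponential shape between abstract block norms (scale weights
inside the norms): the `G₁`-entries are Theorem 3.12 (row B9.Thm3.12, typed), `(QG₁Q*)⁻¹` is (3.132) (row B9.Eq3.132, typed — print: «assuming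
(3.132)»), `RG′D*` is Theorem 3.1 + (3.49); nothing of Theorem 3.13's analytic content beyond the reduction is asserted.  (ii) Right (one-sided)
entries only; the Hölder/mixed/`L²` entries and «Theorems 3.10, 3.11 for 𝔊» (random-walk expansion; positivity — `B9FrakGPos` gives the precise
reading) are not treated; the Laplacian entry is print's exception.  (iii) §3 carries `B9Eq3147.eq_3153`'s hypothesis list verbatim (finite index
types, kernel bases, invertibility and `Δ_a > 0` inputs of the B09 lineage); `K` is any symmetric bond form (print's `G₁` has `K − 2𝒞`,
`B9Eq3152.G1inv_eq`/`B9Delta2Def134.G1inv_eq_Ginv_sub_two_piOp`).  Constants explicit, unoptimised.  NOT summit progress.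

RELATED IN THE TREE, NOT DUPLICATED (searched 2026-08-24: stems `*Thm313*`, `*frakG*`, `*3153*`): pub-balaban `B9Eq3147` (`frakG`, `eq_3153`,
`isUnit_Ginv_det` — USED), `B9Eq3152.sectD_hypotheses` ((3.152) — USED), `B9FrakGPos` (Thm 3.11 reading for 𝔊), r1 `B9.frakG_3153` (ring level),
`B9SectDSup`/`B11SectG` (USED).  Unit `lit-balaban-r06`, HOME `run/shared/lean/pub/lit-balaban/`.
-/

noncomputable section

open scoped BigOperators Matrix

namespace Literature.MathematicalPhysics.QuantumFieldTheory.Balaban1983to89.B9Thm313RightEntries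

open Literature.MathematicalPhysics.QuantumFieldTheory.Balaban1983to89
open B11SectG B6RandomWalk B9SectDSup

/-! ## §1 `𝔊 = G − GDRD*G − GQ*CQG` as a composite of letters -/

section Shape

variable {X n q : Type} [Fintype X] [Fintype n] [Fintype q]

/-- the (3.153) shape as linear maps: `G − GDRD*G − GQ*CQG = G − (GD)∘(RD*G) − (GQ*)∘(C∘(QG))`.
[cite: Balaban1985BackgroundPropagators, (3.153) p.426] -/
theorem mulVecLin_frakG_shape (G : Matrix X X ℝ) (D : Matrix X n ℝ) (R : Matrix n n ℝ) (Qb : Matrix q X ℝ) (C : Matrix q q ℝ) :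
    Matrix.mulVecLin (G - G * D * R * Dᵀ * G - G * Qbᵀ * C * Qb * G) =
      Matrix.mulVecLin G - Matrix.mulVecLin (G * D) ∘ₗ Matrix.mulVecLin (R * Dᵀ * G)
        - Matrix.mulVecLin (G * Qbᵀ) ∘ₗ (Matrix.mulVecLin C ∘ₗ Matrix.mulVecLin (Qb * G)) := by
  refine LinearMap.ext fun μ => ?_
  simp only [LinearMap.sub_apply, LinearMap.comp_apply, Matrix.mulVecLin_apply, Matrix.sub_mulVec, Matrix.mulVec_mulVec,
    Matrix.mul_assoc]

/-- the same with the middle factor rewritten by (3.152) «RD\*G₁ = RG′D\*»: `G − (GD)∘(RG′D*) − (GQ*)∘(C∘(QG))` — the letter `RG′D*` of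
Theorem 3.1 ∘ (3.49). [cite: Balaban1985BackgroundPropagators, (3.152)–(3.153) p.426] -/
theorem mulVecLin_frakG_shape_152 (G : Matrix X X ℝ) (D : Matrix X n ℝ) (R G' : Matrix n n ℝ) (Qb : Matrix q X ℝ) (C : Matrix q q ℝ)
    (h152 : R * Dᵀ * G = R * G' * Dᵀ) :
    Matrix.mulVecLin (G - G * D * R * Dᵀ * G - G * Qbᵀ * C * Qb * G) =
      Matrix.mulVecLin G - Matrix.mulVecLin (G * D) ∘ₗ Matrix.mulVecLin (R * G' * Dᵀ)
        - Matrix.mulVecLin (G * Qbᵀ) ∘ₗ (Matrix.mulVecLin C ∘ₗ Matrix.mulVecLin (Qb * G)) := by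
  rw [mulVecLin_frakG_shape, h152]

end Shape

/-! ## §2 «reduce properties of 𝔊 to the corresponding properties of G₁, (QG₁Q*)⁻¹» — right entries, block-majorant level -/

section Letters

variable {g : B6.Geometry} {FA FC P FQ : Type} [AddCommGroup FA] [Module ℝ FA] [AddCommGroup FC] [Module ℝ FC]
  [AddCommGroup P] [Module ℝ P] [AddCommGroup FQ] [Module ℝ FQ]
variable {bA : BlockNorm g FA} {bC : BlockNorm g FC} {bP : BlockNorm g P} {bQ : BlockNorm g FQ}

/-- **THEOREM 3.13's REDUCTION, RIGHT ENTRIES** ([4] (2.52)–(2.55) three times + «a summation preserves it also»): with the letters `G : bA → bC`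
(`Be^{−δd}`), `GD : bP → bC` (`B′e^{−δd}`), `RGDs : bA → bP` (`B₁e^{−δd}`), `GQs : bQ → bC` (`B_He^{−δd}`), `Cop : bQ → bQ` (`B_Ce^{−δd}`), `QG : bA → bQ`
(`B_Qe^{−δd}`), the operator `G − GD∘RGDs − GQs∘(Cop∘QG)` has the majorant `(B + κ_PB′B₁c + κ_QB_H(κ_QB_CB_Qc)c)·e^{−ρd}` for every `ρ ≧ 0`,
`σ ≧ 0` with `ρ + 2σ ≦ δ`. [cite: Balaban1985BackgroundPropagators, Thm 3.13 p.426, (3.153) p.426]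
[cite: Balaban1984PropagatorsII, (2.52)–(2.55) p.232, (2.61) p.234] -/
theorem hasMaj_frakG_shape {Gop : FA →ₗ[ℝ] FC} {GD : P →ₗ[ℝ] FC} {RGDs : FA →ₗ[ℝ] P} {GQs : FQ →ₗ[ℝ] FC} {Cop : FQ →ₗ[ℝ] FQ}
    {QG : FA →ₗ[ℝ] FQ} {B B' B₁ BH BC BQ δ ρ σ c : ℝ}
    (htri : Triangle254 g) (hd : ∀ a b : g.Site, 0 ≤ g.dist a b) (hrow : RowSum g σ c)
    (hB : 0 ≤ B) (hB' : 0 ≤ B') (hB₁ : 0 ≤ B₁) (hBH : 0 ≤ BH) (hBC : 0 ≤ BC) (hBQ : 0 ≤ BQ)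
    (hρ : 0 ≤ ρ) (hσ : 0 ≤ σ) (hρδ : ρ + 2 * σ ≤ δ)
    (hG : HasMaj bA bC Gop (fun a b => B * Real.exp (-(δ * g.dist a b))))
    (hGD : HasMaj bP bC GD (fun a b => B' * Real.exp (-(δ * g.dist a b))))
    (hRG : HasMaj bA bP RGDs (fun a b => B₁ * Real.exp (-(δ * g.dist a b))))
    (hGQ : HasMaj bQ bC GQs (fun a b => BH * Real.exp (-(δ * g.dist a b))))
    (hC : HasMaj bQ bQ Cop (fun a b => BC * Real.exp (-(δ * g.dist a b))))
    (hQG : HasMaj bA bQ QG (fun a b => BQ * Real.exp (-(δ * g.dist a b)))) :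
    HasMaj bA bC (Gop - GD ∘ₗ RGDs - GQs ∘ₗ (Cop ∘ₗ QG))
      (fun a b => (B + bP.κ * B' * B₁ * c + bQ.κ * BH * (bQ.κ * BC * BQ * c) * c) * Real.exp (-(ρ * g.dist a b))) := by
  have hc : 0 ≤ c ∨ IsEmpty g.Site := by
    by_cases hne : Nonempty g.Site
    · exact Or.inl (hrow.nonneg (Classical.arbitrary _))
    · exact Or.inr (not_nonempty_iff.mp hne)
  rcases hc with hc | hemp
  swap
  · intro y' μ hμ y
    exact (IsEmpty.false y).elim
  have h0 : HasMaj bA bC Gop (fun a b => B * Real.exp (-(ρ * g.dist a b))) := hG.of_rate_le hd hB (by linarith)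
  have h1 : HasMaj bA bC (GD ∘ₗ RGDs) (fun a b => bP.κ * B' * B₁ * c * Real.exp (-(ρ * g.dist a b))) :=
    hasMaj_comp_exp htri hd hrow hB' hB₁ hρ (by linarith) (by linarith) hGD hRG
  have h2 : HasMaj bA bQ (Cop ∘ₗ QG) (fun a b => bQ.κ * BC * BQ * c * Real.exp (-((ρ + σ) * g.dist a b))) :=
    hasMaj_comp_exp htri hd hrow hBC hBQ (by linarith) (by linarith) (by linarith) hC hQG
  have h3 : HasMaj bA bC (GQs ∘ₗ (Cop ∘ₗ QG))
      (fun a b => bQ.κ * BH * (bQ.κ * BC * BQ * c) * c * Real.exp (-(ρ * g.dist a b))) :=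
    hasMaj_comp_exp htri hd hrow hBH (mul_nonneg (mul_nonneg (mul_nonneg bQ.κ_nonneg hBC) hBQ) hc) hρ (by linarith) (by linarith)
      hGQ h2
  exact ((h0.sub h1).sub h3).mono fun a b => le_of_eq (by ring)

end Letters

/-! ## §3 Theorem 3.13's reduction for pub-balaban B09's `𝔊 = frakG` (the identity (3.153) and (3.152) BY NAME) -/

section FrakG

open B9Eq3147

variable {n m τ X q σ : Type} [Fintype n] [Fintype m] [Fintype τ] [Fintype X] [Fintype q] [Fintype σ]
  [DecidableEq n] [DecidableEq m] [DecidableEq τ] [DecidableEq X] [DecidableEq q] [DecidableEq σ]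
variable {g : B6.Geometry} {FC P FQ : Type} [AddCommGroup FC] [Module ℝ FC] [AddCommGroup P] [Module ℝ P]
  [AddCommGroup FQ] [Module ℝ FQ]

/-- **THEOREM 3.13, THE REDUCTION FOR `𝔊` OF (3.148), RIGHT ENTRIES**: under the hypotheses of `B9Eq3147.eq_3153` (finite index types; `K`
symmetric; `Δ = D*D` symmetric with `Δ + aQ′*Q′` invertible; kernel bases `N` of `Q′`, `N_S` of `S = [Q_b ; NᵀΔD*]`; (3.115) `Q_bD = D̄Q′`; the
print's `Δ_a > 0`), `𝔊 = frakG K Δ Q a N D Qb` satisfies (3.153) `𝔊 = G − GDRD*G − GQb*(QbGQb*)⁻¹QbG` with `G = (Ginv K …)⁻¹` and (3.152)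
`RD*G = RG′D*` (both BY NAME), hence — «permit us to reduce properties of 𝔊 to the corresponding properties of G₁, (QG₁Q\*)⁻¹» — its right entries
`𝔊 : bA → bC` have the majorant `(B + κ_PB′B₁c + κ_QB_H(κ_QB_CB_Qc)c)·e^{−ρd}` from the letters for `G` (`Be^{−δd}`), `GD` (`B′`), `RG′D*` (`B₁`),
`GQb*` (`B_H`), `(QbGQb*)⁻¹` (`B_C`, (3.132)), `QbG` (`B_Q`), `ρ + 2σ ≦ δ`. [cite: Balaban1985BackgroundPropagators, Thm 3.13 p.426,
(3.152)–(3.153) p.426, (3.132) p.422] [cite: Balaban1984PropagatorsII, (2.52)–(2.55) p.232, (2.61) p.234] -/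
theorem hasMaj_frakG (eS : X ≃ σ ⊕ (q ⊕ τ)) (e : n ≃ τ ⊕ m) (K : Matrix X X ℝ) (hK : Kᵀ = K) (Δ : Matrix n n ℝ) (Q : Matrix m n ℝ)
    (a : ℝ) (hΔ : Δ.IsSymm) (hΔ' : IsUnit (B9H163.Δ' Δ Q a)) (N : Matrix n τ ℝ) (hQN : Q * N = 0) (hNA : IsUnit (Nᵀ * N).det)
    (hQM : IsUnit (Q * Qᵀ).det) (hTs : IsUnit (Nᵀ * (Δ * Δ) * N).det) (D : Matrix X n ℝ) (hD : Dᵀ * D = Δ)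
    (Qb : Matrix q X ℝ) (Dbar : Matrix q m ℝ) (h115 : Qb * D = Dbar * Q) (ab : ℝ) (hQbM : IsUnit (Qb * Qbᵀ).det)
    (hΔa : (K + D * B9H163.R Δ Q a * Dᵀ + ab • (Qbᵀ * Qb)).PosDef) (NS : Matrix X σ ℝ)
    (hSN : B9Eq3112.dcon Δ N D Qb * NS = 0) (hNSA : IsUnit (NSᵀ * NS).det)
    {bA bC : BlockNorm g (X → ℝ)} {bP : BlockNorm g (n → ℝ)} {bQ : BlockNorm g (q → ℝ)} {B B' B₁ BH BC BQ δ ρ σ c : ℝ}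
    (htri : Triangle254 g) (hd : ∀ a b : g.Site, 0 ≤ g.dist a b) (hrow : RowSum g σ c)
    (hB : 0 ≤ B) (hB' : 0 ≤ B') (hB₁ : 0 ≤ B₁) (hBH : 0 ≤ BH) (hBC : 0 ≤ BC) (hBQ : 0 ≤ BQ)
    (hρ : 0 ≤ ρ) (hσ : 0 ≤ σ) (hρδ : ρ + 2 * σ ≤ δ)
    (hG : HasMaj bA bC (Matrix.mulVecLin (B9SectDFP.Ginv K Δ Q a D Qb ab)⁻¹) (fun a b => B * Real.exp (-(δ * g.dist a b))))
    (hGD : HasMaj bP bC (Matrix.mulVecLin ((B9SectDFP.Ginv K Δ Q a D Qb ab)⁻¹ * D)) (fun a b => B' * Real.exp (-(δ * g.dist a b))))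
    (hRG : HasMaj bA bP (Matrix.mulVecLin (B9H163.R Δ Q a * B9H163.G' Δ Q a * Dᵀ)) (fun a b => B₁ * Real.exp (-(δ * g.dist a b))))
    (hGQ : HasMaj bQ bC (Matrix.mulVecLin ((B9SectDFP.Ginv K Δ Q a D Qb ab)⁻¹ * Qbᵀ)) (fun a b => BH * Real.exp (-(δ * g.dist a b))))
    (hC : HasMaj bQ bQ (Matrix.mulVecLin (Qb * (B9SectDFP.Ginv K Δ Q a D Qb ab)⁻¹ * Qbᵀ)⁻¹) (fun a b => BC * Real.exp (-(δ * g.dist a b))))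
    (hQG : HasMaj bA bQ (Matrix.mulVecLin (Qb * (B9SectDFP.Ginv K Δ Q a D Qb ab)⁻¹)) (fun a b => BQ * Real.exp (-(δ * g.dist a b)))) :
    HasMaj bA bC (Matrix.mulVecLin (frakG K Δ Q a N D Qb))
      (fun a b => (B + bP.κ * B' * B₁ * c + bQ.κ * BH * (bQ.κ * BC * BQ * c) * c) * Real.exp (-(ρ * g.dist a b))) := by
  -- (3.153), third member, and (3.152), first member — BY NAME
  obtain ⟨-, -, h3153, -⟩ := eq_3153 eS e K hK Δ Q a hΔ hΔ' N hQN hNA hQM hTs D hD Qb Dbar h115 ab hQbM hΔa NS hSN hNSA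
  have hGu := isUnit_Ginv_det K hK Δ Q a hΔ hΔ' hQM D hD Qb Dbar h115 ab hΔa
  obtain ⟨⟨h152, -⟩, -, -⟩ := B9Eq3152.sectD_hypotheses e K hK Δ Q a hΔ hΔ' N hQN hNA hQM hTs D hD Qb Dbar h115 ab hGu
  rw [h3153, mulVecLin_frakG_shape_152 _ D _ (B9H163.G' Δ Q a) Qb _ h152]
  exact hasMaj_frakG_shape htri hd hrow hB hB' hB₁ hBH hBC hBQ hρ hσ hρδ hG hGD hRG hGQ hC hQG

end FrakG

/-! ## §4 The companion reduction for `𝔓 = I − G₁Q*(QG₁Q*)⁻¹Q − G₁DRD*` ((3.147)): `I − 𝔓` from the letters -/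

section FrakP

variable {X n q : Type} [Fintype X] [Fintype n] [Fintype q]

/-- the (3.147) shape as linear maps: `GQ*CQ + GDRD* = (GQ*)∘(C∘Q) + (GD)∘(RD*)`. [cite: Balaban1985BackgroundPropagators, (3.147) p.425] -/
theorem mulVecLin_one_sub_frakP_shape (G : Matrix X X ℝ) (D : Matrix X n ℝ) (R : Matrix n n ℝ) (Qb : Matrix q X ℝ) (C : Matrix q q ℝ) :
    Matrix.mulVecLin (G * Qbᵀ * C * Qb + G * D * R * Dᵀ) =
      Matrix.mulVecLin (G * Qbᵀ) ∘ₗ (Matrix.mulVecLin C ∘ₗ Matrix.mulVecLin Qb)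
        + Matrix.mulVecLin (G * D) ∘ₗ Matrix.mulVecLin (R * Dᵀ) := by
  refine LinearMap.ext fun μ => ?_
  simp only [LinearMap.add_apply, LinearMap.comp_apply, Matrix.mulVecLin_apply, Matrix.add_mulVec, Matrix.mulVec_mulVec,
    Matrix.mul_assoc]

variable {g : B6.Geometry} {FA FC P FQ : Type} [AddCommGroup FA] [Module ℝ FA] [AddCommGroup FC] [Module ℝ FC]
  [AddCommGroup P] [Module ℝ P] [AddCommGroup FQ] [Module ℝ FQ]
variable {bA : BlockNorm g FA} {bC : BlockNorm g FC} {bP : BlockNorm g P} {bQ : BlockNorm g FQ}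

/-- **THEOREM 3.13's REDUCTION FOR `𝔓`, THE PART `I − 𝔓 = G₁Q*(QG₁Q*)⁻¹Q + G₁DRD*`** ([4] (2.52)–(2.55)): letters `GQs : bQ → bC` (`B_He^{−δd}`),
`Cop : bQ → bQ` (`B_Ce^{−δd}`, (3.132)), `Qop : bA → bQ` (`B_Qe^{−δd}`, the averaging), `GD : bP → bC` (`B′e^{−δd}`), `RDs : bA → bP` (`B_Re^{−δd}`,
`RD*` — print's reduction to `G′`, `(Q′G′²Q′*)⁻¹` through `R` of (3.21)) ⟹ `GQs∘(Cop∘Qop) + GD∘RDs` has `(κ_QB_H(κ_QB_CB_Qc)c + κ_PB′B_Rc)·e^{−ρd}`,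
`ρ + 2σ ≦ δ`. [cite: Balaban1985BackgroundPropagators, Thm 3.13 p.426, (3.147) p.425] [cite: Balaban1984PropagatorsII, (2.52)–(2.55) p.232, (2.61) p.234] -/
theorem hasMaj_one_sub_frakP_shape {GQs : FQ →ₗ[ℝ] FC} {Cop : FQ →ₗ[ℝ] FQ} {Qop : FA →ₗ[ℝ] FQ} {GD : P →ₗ[ℝ] FC}
    {RDs : FA →ₗ[ℝ] P} {BH BC BQ B' BR δ ρ σ c : ℝ}
    (htri : Triangle254 g) (hd : ∀ a b : g.Site, 0 ≤ g.dist a b) (hrow : RowSum g σ c)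
    (hBH : 0 ≤ BH) (hBC : 0 ≤ BC) (hBQ : 0 ≤ BQ) (hB' : 0 ≤ B') (hBR : 0 ≤ BR) (hρ : 0 ≤ ρ) (hσ : 0 ≤ σ) (hρδ : ρ + 2 * σ ≤ δ)
    (hGQ : HasMaj bQ bC GQs (fun a b => BH * Real.exp (-(δ * g.dist a b))))
    (hC : HasMaj bQ bQ Cop (fun a b => BC * Real.exp (-(δ * g.dist a b))))
    (hQ : HasMaj bA bQ Qop (fun a b => BQ * Real.exp (-(δ * g.dist a b))))
    (hGD : HasMaj bP bC GD (fun a b => B' * Real.exp (-(δ * g.dist a b))))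
    (hRDs : HasMaj bA bP RDs (fun a b => BR * Real.exp (-(δ * g.dist a b)))) :
    HasMaj bA bC (GQs ∘ₗ (Cop ∘ₗ Qop) + GD ∘ₗ RDs)
      (fun a b => (bQ.κ * BH * (bQ.κ * BC * BQ * c) * c + bP.κ * B' * BR * c) * Real.exp (-(ρ * g.dist a b))) := by
  have hc : 0 ≤ c ∨ IsEmpty g.Site := by
    by_cases hne : Nonempty g.Site
    · exact Or.inl (hrow.nonneg (Classical.arbitrary _))
    · exact Or.inr (not_nonempty_iff.mp hne)
  rcases hc with hc | hemp
  swap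
  · intro y' μ hμ y
    exact (IsEmpty.false y).elim
  have h2 : HasMaj bA bQ (Cop ∘ₗ Qop) (fun a b => bQ.κ * BC * BQ * c * Real.exp (-((ρ + σ) * g.dist a b))) :=
    hasMaj_comp_exp htri hd hrow hBC hBQ (by linarith) (by linarith) (by linarith) hC hQ
  have h3 : HasMaj bA bC (GQs ∘ₗ (Cop ∘ₗ Qop))
      (fun a b => bQ.κ * BH * (bQ.κ * BC * BQ * c) * c * Real.exp (-(ρ * g.dist a b))) :=
    hasMaj_comp_exp htri hd hrow hBH (mul_nonneg (mul_nonneg (mul_nonneg bQ.κ_nonneg hBC) hBQ) hc) hρ (by linarith) (by linarith)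
      hGQ h2
  have h1 : HasMaj bA bC (GD ∘ₗ RDs) (fun a b => bP.κ * B' * BR * c * Real.exp (-(ρ * g.dist a b))) :=
    hasMaj_comp_exp htri hd hrow hB' hBR hρ (by linarith) (by linarith) hGD hRDs
  exact (h3.add h1).mono fun a b => le_of_eq (by ring)

end FrakP

section FrakPConcrete

open B9Eq3147

variable {n m τ X q σ : Type} [Fintype n] [Fintype m] [Fintype τ] [Fintype X] [Fintype q] [Fintype σ]
  [DecidableEq n] [DecidableEq m] [DecidableEq τ] [DecidableEq X] [DecidableEq q] [DecidableEq σ]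
variable {g : B6.Geometry} {FC P FQ : Type} [AddCommGroup FC] [Module ℝ FC] [AddCommGroup P] [Module ℝ P]
  [AddCommGroup FQ] [Module ℝ FQ]

/-- **THE REDUCTION FOR pub-balaban B09's `𝔓 = frakP`** ((3.147) `𝔓 = I − GQb*(QbGQb*)⁻¹Qb − GDRD*` BY NAME, `B9Eq3147.eq_3147`): `I − 𝔓 : bA → bC` has
the majorant `(κ_QB_H(κ_QB_CB_Qc)c + κ_PB′B_Rc)·e^{−ρd}` from the letters `GQb*`, `(QbGQb*)⁻¹`, `Qb`, `GD`, `RD*`.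
[cite: Balaban1985BackgroundPropagators, Thm 3.13 p.426, (3.147) p.425] [cite: Balaban1984PropagatorsII, (2.52)–(2.55) p.232] -/
theorem hasMaj_one_sub_frakP (eS : X ≃ σ ⊕ (q ⊕ τ)) (e : n ≃ τ ⊕ m) (K : Matrix X X ℝ) (hK : Kᵀ = K) (Δ : Matrix n n ℝ)
    (Q : Matrix m n ℝ) (a : ℝ) (hΔ : Δ.IsSymm) (hΔ' : IsUnit (B9H163.Δ' Δ Q a)) (N : Matrix n τ ℝ) (hQN : Q * N = 0)
    (hNA : IsUnit (Nᵀ * N).det) (hQM : IsUnit (Q * Qᵀ).det) (hTs : IsUnit (Nᵀ * (Δ * Δ) * N).det) (D : Matrix X n ℝ)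
    (hD : Dᵀ * D = Δ) (Qb : Matrix q X ℝ) (Dbar : Matrix q m ℝ) (h115 : Qb * D = Dbar * Q) (ab : ℝ) (hQbM : IsUnit (Qb * Qbᵀ).det)
    (hΔa : (K + D * B9H163.R Δ Q a * Dᵀ + ab • (Qbᵀ * Qb)).PosDef) (NS : Matrix X σ ℝ)
    (hSN : B9Eq3112.dcon Δ N D Qb * NS = 0) (hNSA : IsUnit (NSᵀ * NS).det)
    {bA bC : BlockNorm g (X → ℝ)} {bP : BlockNorm g (n → ℝ)} {bQ : BlockNorm g (q → ℝ)} {BH BC BQ B' BR δ ρ σ c : ℝ}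
    (htri : Triangle254 g) (hd : ∀ a b : g.Site, 0 ≤ g.dist a b) (hrow : RowSum g σ c)
    (hBH : 0 ≤ BH) (hBC : 0 ≤ BC) (hBQ : 0 ≤ BQ) (hB' : 0 ≤ B') (hBR : 0 ≤ BR) (hρ : 0 ≤ ρ) (hσ : 0 ≤ σ) (hρδ : ρ + 2 * σ ≤ δ)
    (hGQ : HasMaj bQ bC (Matrix.mulVecLin ((B9SectDFP.Ginv K Δ Q a D Qb ab)⁻¹ * Qbᵀ)) (fun a b => BH * Real.exp (-(δ * g.dist a b))))
    (hC : HasMaj bQ bQ (Matrix.mulVecLin (Qb * (B9SectDFP.Ginv K Δ Q a D Qb ab)⁻¹ * Qbᵀ)⁻¹) (fun a b => BC * Real.exp (-(δ * g.dist a b))))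
    (hQ : HasMaj bA bQ (Matrix.mulVecLin Qb) (fun a b => BQ * Real.exp (-(δ * g.dist a b))))
    (hGD : HasMaj bP bC (Matrix.mulVecLin ((B9SectDFP.Ginv K Δ Q a D Qb ab)⁻¹ * D)) (fun a b => B' * Real.exp (-(δ * g.dist a b))))
    (hRDs : HasMaj bA bP (Matrix.mulVecLin (B9H163.R Δ Q a * Dᵀ)) (fun a b => BR * Real.exp (-(δ * g.dist a b)))) :
    HasMaj bA bC (Matrix.mulVecLin (1 - frakP K Δ Q a N D Qb ab))
      (fun a b => (bQ.κ * BH * (bQ.κ * BC * BQ * c) * c + bP.κ * B' * BR * c) * Real.exp (-(ρ * g.dist a b))) := by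
  have h3147 := eq_3147 eS e K hK Δ Q a hΔ hΔ' N hQN hNA hQM hTs D hD Qb Dbar h115 ab hQbM hΔa NS hSN hNSA
  have hshape : 1 - frakP K Δ Q a N D Qb ab =
      (B9SectDFP.Ginv K Δ Q a D Qb ab)⁻¹ * Qbᵀ * (Qb * (B9SectDFP.Ginv K Δ Q a D Qb ab)⁻¹ * Qbᵀ)⁻¹ * Qb +
        (B9SectDFP.Ginv K Δ Q a D Qb ab)⁻¹ * D * B9H163.R Δ Q a * Dᵀ := by
    rw [h3147]; abel
  rw [hshape, mulVecLin_one_sub_frakP_shape]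
  exact hasMaj_one_sub_frakP_shape htri hd hrow hBH hBC hBQ hB' hBR hρ hσ hρδ hGQ hC hQ hGD hRDs

end FrakPConcrete

/-! ## §5 (3.153)'s outer members «𝔊 = G₁𝔓* = 𝔓G₁»: entries of `𝔊` from those of `𝔓` and `G₁` -/

section ViaFrakP

open B9Eq3147

variable {n m τ X q σ : Type} [Fintype n] [Fintype m] [Fintype τ] [Fintype X] [Fintype q] [Fintype σ]
  [DecidableEq n] [DecidableEq m] [DecidableEq τ] [DecidableEq X] [DecidableEq q] [DecidableEq σ]
variable {g : B6.Geometry}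

/-- **(3.153), THE MEMBER «𝔊 = 𝔓G₁»** (first conjunct of `B9Eq3147.eq_3153`, BY NAME): from the letters `𝔓 : bC → bC′` (`B_𝔓e^{−δ₁d}`) and
`G : bA → bC` (`Be^{−δ₂d}`) the propagator `𝔊 = 𝔓∘G` has the majorant `κ_C B_𝔓 B c·e^{−ρd}` for `0 ≦ ρ ≦ δ₂`, `ρ + σ ≦ δ₁` ([4] (2.52)–(2.55)).
[cite: Balaban1985BackgroundPropagators, (3.153) p.426, Thm 3.13 p.426] [cite: Balaban1984PropagatorsII, (2.52)–(2.55) p.232, (2.61) p.234] -/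
theorem hasMaj_frakG_of_frakP (eS : X ≃ σ ⊕ (q ⊕ τ)) (e : n ≃ τ ⊕ m) (K : Matrix X X ℝ) (hK : Kᵀ = K) (Δ : Matrix n n ℝ)
    (Q : Matrix m n ℝ) (a : ℝ) (hΔ : Δ.IsSymm) (hΔ' : IsUnit (B9H163.Δ' Δ Q a)) (N : Matrix n τ ℝ) (hQN : Q * N = 0)
    (hNA : IsUnit (Nᵀ * N).det) (hQM : IsUnit (Q * Qᵀ).det) (hTs : IsUnit (Nᵀ * (Δ * Δ) * N).det) (D : Matrix X n ℝ)
    (hD : Dᵀ * D = Δ) (Qb : Matrix q X ℝ) (Dbar : Matrix q m ℝ) (h115 : Qb * D = Dbar * Q) (ab : ℝ) (hQbM : IsUnit (Qb * Qbᵀ).det)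
    (hΔa : (K + D * B9H163.R Δ Q a * Dᵀ + ab • (Qbᵀ * Qb)).PosDef) (NS : Matrix X σ ℝ)
    (hSN : B9Eq3112.dcon Δ N D Qb * NS = 0) (hNSA : IsUnit (NSᵀ * NS).det)
    {bA bC bC' : BlockNorm g (X → ℝ)} {BP B δ₁ δ₂ ρ σ' c : ℝ}
    (htri : Triangle254 g) (hd : ∀ a b : g.Site, 0 ≤ g.dist a b) (hrow : RowSum g σ' c) (hBP : 0 ≤ BP) (hB : 0 ≤ B)
    (hρ : 0 ≤ ρ) (hρ₂ : ρ ≤ δ₂) (hρ₁ : ρ + σ' ≤ δ₁)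
    (hP : HasMaj bC bC' (Matrix.mulVecLin (frakP K Δ Q a N D Qb ab)) (fun a b => BP * Real.exp (-(δ₁ * g.dist a b))))
    (hG : HasMaj bA bC (Matrix.mulVecLin (B9SectDFP.Ginv K Δ Q a D Qb ab)⁻¹) (fun a b => B * Real.exp (-(δ₂ * g.dist a b)))) :
    HasMaj bA bC' (Matrix.mulVecLin (frakG K Δ Q a N D Qb))
      (fun a b => bC.κ * BP * B * c * Real.exp (-(ρ * g.dist a b))) := by
  obtain ⟨h1, -, -, -⟩ := eq_3153 eS e K hK Δ Q a hΔ hΔ' N hQN hNA hQM hTs D hD Qb Dbar h115 ab hQbM hΔa NS hSN hNSA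
  rw [h1, Matrix.mulVecLin_mul]
  exact hasMaj_comp_exp htri hd hrow hBP hB hρ hρ₂ hρ₁ hP hG

/-- **(3.153), THE MEMBER «𝔊 = G₁𝔓\*»** (second conjunct of `B9Eq3147.eq_3153`, BY NAME): from the letters `G : bC → bC′` (`Be^{−δ₁d}`) and
`𝔓* : bA → bC` (`B′_𝔓e^{−δ₂d}`) the propagator `𝔊 = G∘𝔓*` has the majorant `κ_C B B′_𝔓 c·e^{−ρd}` for `0 ≦ ρ ≦ δ₂`, `ρ + σ ≦ δ₁`.
[cite: Balaban1985BackgroundPropagators, (3.153) p.426, Thm 3.13 p.426] [cite: Balaban1984PropagatorsII, (2.52)–(2.55) p.232, (2.61) p.234] -/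
theorem hasMaj_frakG_of_frakP_transpose (eS : X ≃ σ ⊕ (q ⊕ τ)) (e : n ≃ τ ⊕ m) (K : Matrix X X ℝ) (hK : Kᵀ = K) (Δ : Matrix n n ℝ)
    (Q : Matrix m n ℝ) (a : ℝ) (hΔ : Δ.IsSymm) (hΔ' : IsUnit (B9H163.Δ' Δ Q a)) (N : Matrix n τ ℝ) (hQN : Q * N = 0)
    (hNA : IsUnit (Nᵀ * N).det) (hQM : IsUnit (Q * Qᵀ).det) (hTs : IsUnit (Nᵀ * (Δ * Δ) * N).det) (D : Matrix X n ℝ)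
    (hD : Dᵀ * D = Δ) (Qb : Matrix q X ℝ) (Dbar : Matrix q m ℝ) (h115 : Qb * D = Dbar * Q) (ab : ℝ) (hQbM : IsUnit (Qb * Qbᵀ).det)
    (hΔa : (K + D * B9H163.R Δ Q a * Dᵀ + ab • (Qbᵀ * Qb)).PosDef) (NS : Matrix X σ ℝ)
    (hSN : B9Eq3112.dcon Δ N D Qb * NS = 0) (hNSA : IsUnit (NSᵀ * NS).det)
    {bA bC bC' : BlockNorm g (X → ℝ)} {B BP' δ₁ δ₂ ρ σ' c : ℝ}
    (htri : Triangle254 g) (hd : ∀ a b : g.Site, 0 ≤ g.dist a b) (hrow : RowSum g σ' c) (hB : 0 ≤ B) (hBP' : 0 ≤ BP')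
    (hρ : 0 ≤ ρ) (hρ₂ : ρ ≤ δ₂) (hρ₁ : ρ + σ' ≤ δ₁)
    (hG : HasMaj bC bC' (Matrix.mulVecLin (B9SectDFP.Ginv K Δ Q a D Qb ab)⁻¹) (fun a b => B * Real.exp (-(δ₁ * g.dist a b))))
    (hPt : HasMaj bA bC (Matrix.mulVecLin (frakP K Δ Q a N D Qb ab)ᵀ) (fun a b => BP' * Real.exp (-(δ₂ * g.dist a b)))) :
    HasMaj bA bC' (Matrix.mulVecLin (frakG K Δ Q a N D Qb))
      (fun a b => bC.κ * B * BP' * c * Real.exp (-(ρ * g.dist a b))) := by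
  obtain ⟨-, h2, -, -⟩ := eq_3153 eS e K hK Δ Q a hΔ hΔ' N hQN hNA hQM hTs D hD Qb Dbar h115 ab hQbM hΔa NS hSN hNSA
  rw [h2, Matrix.mulVecLin_mul]
  exact hasMaj_comp_exp htri hd hrow hB hBP' hρ hρ₂ hρ₁ hG hPt

end ViaFrakP

end Literature.MathematicalPhysics.QuantumFieldTheory.Balaban1983to89.B9Thm313RightEntries

end
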